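import Mathlib
import HarnessLib
import Summits.ResolutionOfSingularities.ResolutionOfSingularities.Theorems.WildQuotientsWildQuotientResolutionKSBlowupLocalChartCentre
import Summits.ResolutionOfSingularities.ResolutionOfSingularities.Theorems.WildQuotientsWildQuotientResolutionKSBlowupFixedPointPClosed

/-!
# Kollár–Szabó going down for a general stable centre through `x` with `I_x = 𝔪_x` (e.g. the ORBIT `G·x`):
# the blow-up along `I` has a closed regular fixed point over `x` with the same p-closed inertia
# (crux `WildQuotients.WildQuotientResolution`, stub `stub_phaseZeroHighDim`)

Crux stmt-ResolutionOfSingularities-15640 (`WildQuotientResolution`), registered stub `stub_phaseZeroHighDim`;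
programme PHASE0-KS-EIGENLINE. The Phase-0 game blows up `G`-stable centres, in particular ORBITS `G·x` of closed
points (finite stable closed sets), whose ideal sheaf `I = 𝓘_{G·x}` has stalk `I_x = 𝔪_x` at `x`. Hand 8-g2's chain was
written for the centre `{x}`; this file re-runs the two centre-sensitive steps for an arbitrary `σ`-stable ideal sheaf
`I` with `I_x = 𝔪_x` (✓`KSBlowupLocalChartCentre` for the chart; here the stalk identification and the assembly):

* `stalkClosedPointTo_surjective_of_isQuadraticTransform_of_stalkIdeal`,
  `nonempty_stalk_ringEquiv_of_isQuadraticTransform_of_stalkIdeal` — `𝒪_{X',x'} ≅ R` for the blow-up along `I`;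
* `exists_fixedPoint_liftAction_of_normal_isPGroup_of_centre`, ★ `exists_fixedPoint_liftAction_step_of_normal_isPGroup_of_centre`
  — **for a finite p-closed `G ⊵ P ⊇ [G,G]` with `g ∈ I_x` for all `g` (apply to the stabiliser of `x`), `κ(x)`
  algebraically closed of characteristic `p`, `𝒪_{X,x}` regular, not a field, and ANY blowing up `π : X' → X` along a
  `σ`-stable `I ≠ 0` with `I_x = 𝔪_x`, with the lifted action: `X'` integral + locally Noetherian and a CLOSED `x'`
  over `x` in the inertia of every `g`, `𝒪_{X',x'}` regular, not a field, same dimension, `κ(x') ≅ κ(x)`.**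

[OURS · crux stmt-ResolutionOfSingularities-15640 · helper toward `stub_phaseZeroHighDim` (orbit/general-centre form
of the Kollár–Szabó fixed point; NOT a proof of the stub); counted 0; AI-level work, weaker than expert review.]
[cite: ReichsteinYoussin2000, Appendix (Kollár–Szabó), Lemma A.1 and Prop. A.2]
-/

-- single-problem summit: the doubled namespace component `ResolutionOfSingularities` is forced
set_option linter.dupNamespace false

noncomputable section

open CategoryTheory CategoryTheory.Limits AlgebraicGeometry TopologicalSpace IsLocalRing
open Literature.AlgebraicGeometry.Ramification Literature.AlgebraicGeometry.Resolution
open Scheme.IdealSheafData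
open Summit.ResolutionOfSingularities.ResolutionOfSingularities.Theorems.WildQuotientResolution

namespace Summit.ResolutionOfSingularities.ResolutionOfSingularities.Theorems.WildQuotientResolution.KSGoingDown

universe u

section Stalk

variable {X' X : Scheme.{u}} {π : X' ⟶ X} {x : X} [IsIntegral X]

set_option maxHeartbeats 800000 in
-- the stalk maps of the blowing up and the `Subring K` coercions elaborate large terms (cf.
-- `BlowupExceptionalGenericOrder.lean`)
/-- **`stalkClosedPointTo φ : 𝒪_{X',x'} → R` is surjective** when `R ⊆ Frac 𝒪_{X,x}` is a quadratic transform
of the image `S` of `𝒪_{X,x}`, `ι` is the (local) inclusion and `π` is the blowing up of a centre `I` with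
`I_x = 𝔪_x` (e.g. a finite set of closed points through `x`, or any centre for which `x` is a reduced isolated point): `𝔪_x 𝒪_{X',x'}` is principal (effective Cartier) and — by locality of `ψ` — generated by `π♯ x₀` for the
element `x₀` of the chart `S[𝔪/x₀] ⊆ R`; hence `S[𝔪/x₀] ⊆ ψ(𝒪_{X',x'})`, and the unit denominators of
`R = S[𝔪/x₀]_𝔫` lift to units. [cite: StacksProject, Tag 0804] -/
theorem stalkClosedPointTo_surjective_of_isQuadraticTransform_of_stalkIdeal [IsIntegral X']
    {I : X.IdealSheafData} (hπ : IsBlowup π I) (hIx : stalkIdeal I x = maximalIdeal (X.presheaf.stalk x))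
    (R : Subring (FractionRing (X.presheaf.stalk x))) [IsLocalRing R]
    (hQT : IsQuadraticTransform (algebraMap (X.presheaf.stalk x) (FractionRing (X.presheaf.stalk x))).range R)
    (ι : X.presheaf.stalk x →+* R) [IsLocalHom ι]
    (hι : ∀ a, ((ι a : R) : FractionRing (X.presheaf.stalk x)) =
      algebraMap (X.presheaf.stalk x) (FractionRing (X.presheaf.stalk x)) a)
    (φ : Spec (.of R) ⟶ X') (hφ : φ ≫ π = Spec.map (CommRingCat.ofHom ι) ≫ X.fromSpecStalk x) :
    Function.Surjective (Scheme.stalkClosedPointTo φ).hom := by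
  classical
  set K := FractionRing (X.presheaf.stalk x) with hK
  set S : Subring K := (algebraMap (X.presheaf.stalk x) K).range with hS
  set y := φ (closedPoint R) with hy
  set ψ := (Scheme.stalkClosedPointTo φ).hom with hψ
  set T := (π.stalkMap y).hom with hT
  have hyx : π y = x := π_apply_closedPoint_eq ι φ hφ
  -- the specialization isomorphism `σ₀ : 𝒪_{X,π y} ≅ 𝒪_{X,x}` and the structure map
  set σ₀ := (X.presheaf.stalkSpecializes (specializes_of_eq hyx.symm)).hom with hσ₀
  set σ₁ := (X.presheaf.stalkSpecializes (specializes_of_eq hyx)).hom with hσ₁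
  have hσ₁₀ : ∀ a, σ₁ (σ₀ a) = a := fun a => by
    rw [hσ₀, hσ₁, ← CommRingCat.comp_apply, TopCat.Presheaf.stalkSpecializes_comp]
    simp
  have hσ₀₁ : ∀ a, σ₀ (σ₁ a) = a := fun a => by
    rw [hσ₀, hσ₁, ← CommRingCat.comp_apply, TopCat.Presheaf.stalkSpecializes_comp]
    simp
  have hcomp : ∀ a, ψ (T a) = ι (σ₀ a) := fun a => stalkClosedPointTo_stalkMap_apply ι φ hφ a
  have hcomp' : ∀ a, ψ (T (σ₁ a)) = ι a := fun a => by rw [hcomp, hσ₀₁]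
  -- unpack the quadratic transform: the chart element `x₀`
  obtain ⟨hSloc, xK, hxK𝔪, hxK0, -, hBle, hfrac, hdom⟩ := hQT
  obtain ⟨a₀, ha₀⟩ : ∃ a₀ : X.presheaf.stalk x, algebraMap _ K a₀ = (xK : K) := xK.2
  have ha₀𝔪 : a₀ ∈ maximalIdeal (X.presheaf.stalk x) := by
    apply mem_maximalIdeal_of_algebraMap_mem
    have : (⟨algebraMap _ K a₀, ⟨a₀, rfl⟩⟩ : S) = xK := Subtype.ext ha₀
    rw [this]
    exact hxK𝔪
  have hxK0' : (xK : K) ≠ 0 := fun h => hxK0 (Subtype.ext h)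
  have hSR : S ≤ R := (le_blowupRing S (xK : K)).trans hBle
  -- `tR = ι a₀`, the chart element read in `R`
  set tR : R := ι a₀ with htR
  have htRK : (tR : K) = (xK : K) := by rw [htR, hι, ha₀]
  have htR0 : tR ≠ 0 := fun h => hxK0' (by rw [← htRK, h]; rfl)
  -- `𝔪_x · R = tR · R`
  have hmap : (maximalIdeal (X.presheaf.stalk x)).map ι = Ideal.span {tR} := by
    apply le_antisymm
    · refine (Ideal.map_le_iff_le_comap).mpr fun m hm => ?_
      have hmS : (⟨algebraMap _ K m, ⟨m, rfl⟩⟩ : S) ∈ maximalIdeal S := by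
        rw [IsLocalRing.mem_maximalIdeal]
        intro hu
        obtain ⟨h0, hinv⟩ := (isUnit_subring_iff_inv_mem _).mp hu
        have hinvR : (algebraMap _ K m)⁻¹ ∈ R := hSR hinv
        have hιm : ((ι m : R) : K) = algebraMap _ K m := hι m
        have : IsUnit (ι m) := (isUnit_subring_iff_inv_mem _).mpr ⟨by rw [hιm]; exact h0, by
          rw [hιm]; exact hinvR⟩
        exact not_isUnit_of_mem_maximalIdeal ι hm this
      have hq : algebraMap _ K m / (xK : K) ∈ R := hBle (div_mem_blowupRing _ hmS)
      rw [Ideal.mem_comap, Ideal.mem_span_singleton']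
      refine ⟨⟨_, hq⟩, Subtype.ext ?_⟩
      change algebraMap _ K m / (xK : K) * (tR : K) = ((ι m : R) : K)
      rw [htRK, hι, div_mul_cancel₀ _ hxK0']
    · rw [Ideal.span_le, Set.singleton_subset_iff]
      exact Ideal.mem_map_of_mem ι ha₀𝔪
  -- `𝔪_{π y} 𝒪_{X',y}` is principal, generated by `T (σ₁ a₀)`
  obtain ⟨g, hg0, hg⟩ := hπ.isEffectiveCartier.exists_stalkIdeal_eq_span y
  have hstalk : stalkIdeal I (π y) = maximalIdeal _ := by
    have : ∀ z (hz : z = x), stalkIdeal I z = maximalIdeal _ := by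
      rintro z rfl; exact hIx
    exact this _ hyx
  rw [stalkIdeal_comap_eq_map, hstalk] at hg
  -- images under `ψ`
  have hψmap : ((maximalIdeal (X.presheaf.stalk (π y))).map T).map ψ = Ideal.span {tR} := by
    rw [← hmap, Ideal.map_map]
    apply le_antisymm
    · refine (Ideal.map_le_iff_le_comap).mpr fun m hm => ?_
      rw [Ideal.mem_comap, RingHom.comp_apply, hcomp]
      refine Ideal.mem_map_of_mem ι ?_
      have h1 : ¬ IsUnit (σ₀ m) := fun hu => (IsLocalRing.mem_maximalIdeal _).mp hm (by
        have := hu.map σ₁; rwa [hσ₁₀] at this)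
      exact (IsLocalRing.mem_maximalIdeal _).mpr h1
    · refine (Ideal.map_le_iff_le_comap).mpr fun m hm => ?_
      rw [Ideal.mem_comap, ← hcomp' m]
      have h1 : ¬ IsUnit (σ₁ m) := fun hu => (IsLocalRing.mem_maximalIdeal _).mp hm (by
        have := hu.map σ₀; rwa [hσ₀₁] at this)
      exact Ideal.mem_map_of_mem (ψ.comp T) ((IsLocalRing.mem_maximalIdeal _).mpr h1)
  rw [hg, Ideal.map_span, Set.image_singleton] at hψmap
  -- `T (σ₁ a₀) = g * w` with `ψ w` a unit, hence `w` a unit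
  have ha₀T : T (σ₁ a₀) ∈ Ideal.span {g} := by
    rw [← hg]
    refine Ideal.mem_map_of_mem _ ?_
    have h1 : ¬ IsUnit (σ₁ a₀) := fun hu => (IsLocalRing.mem_maximalIdeal _).mp ha₀𝔪 (by
      have := hu.map σ₀; rwa [hσ₀₁] at this)
    exact (IsLocalRing.mem_maximalIdeal _).mpr h1
  obtain ⟨w, hw⟩ := Ideal.mem_span_singleton'.mp ha₀T
  have hψg : ψ g ∈ Ideal.span {tR} := hψmap ▸ Ideal.subset_span rfl
  obtain ⟨v, hv⟩ := Ideal.mem_span_singleton'.mp hψg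
  have hwu : IsUnit w := by
    have h1 : tR = v * ψ w * tR := by
      have := congrArg ψ hw
      rw [map_mul, hcomp', ← hv] at this
      -- this : ψ w * (v * tR) = tR
      linear_combination (-1 : R) * this
    have h2 : v * ψ w = 1 := by
      have h3 : (v * ψ w - 1) * tR = 0 := by linear_combination (-1 : R) * h1
      rcases mul_eq_zero.mp h3 with h | h
      · exact (sub_eq_zero.mp h)
      · exact absurd h htR0
    have hψw : IsUnit (ψ w) := IsUnit.of_mul_eq_one_right v h2
    exact (isUnit_map_iff ψ w).mp hψw
  -- every `m ∈ 𝔪_{π y}` is `T(σ₁ a₀) · M'`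
  have hdiv : ∀ m ∈ maximalIdeal (X.presheaf.stalk x),
      ∃ M', T (σ₁ m) = T (σ₁ a₀) * M' := by
    intro m hm
    have h1 : T (σ₁ m) ∈ Ideal.span {g} := by
      rw [← hg]
      refine Ideal.mem_map_of_mem _ ?_
      have h1 : ¬ IsUnit (σ₁ m) := fun hu => (IsLocalRing.mem_maximalIdeal _).mp hm (by
        have := hu.map σ₀; rwa [hσ₀₁] at this)
      exact (IsLocalRing.mem_maximalIdeal _).mpr h1
    obtain ⟨c, hc⟩ := Ideal.mem_span_singleton'.mp h1
    refine ⟨c * ↑(hwu.unit⁻¹), ?_⟩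
    rw [← hw, ← hc]
    have : w * ↑(hwu.unit⁻¹) = 1 := hwu.mul_val_inv
    linear_combination (-(c * g)) * this
  -- the image of `ψ` read in `K` contains the chart `S[𝔪/x₀]`
  let Q : Subring K := (ψ.range).map R.subtype
  have hQ : ∀ z : K, z ∈ Q ↔ ∃ Z, ((ψ Z : R) : K) = z := by
    intro z
    simp only [Q, Subring.mem_map, RingHom.mem_range, Subring.coe_subtype]
    constructor
    · rintro ⟨r, ⟨Z, rfl⟩, rfl⟩; exact ⟨Z, rfl⟩
    · rintro ⟨Z, hZ⟩; exact ⟨ψ Z, ⟨Z, rfl⟩, hZ⟩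
  have hBQ : blowupRing S (xK : K) ≤ Q := by
    refine Subring.closure_le.mpr ?_
    rintro z (⟨a, rfl⟩ | ⟨m, hm, rfl⟩)
    · exact (hQ _).mpr ⟨T (σ₁ a), by rw [hcomp', hι]⟩
    · obtain ⟨m₀, hm₀⟩ : ∃ m₀ : X.presheaf.stalk x, algebraMap _ K m₀ = (m : K) := m.2
      have hm₀𝔪 : m₀ ∈ maximalIdeal (X.presheaf.stalk x) := by
        apply mem_maximalIdeal_of_algebraMap_mem
        have : (⟨algebraMap _ K m₀, ⟨m₀, rfl⟩⟩ : S) = m := Subtype.ext hm₀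
        rw [this]
        exact hm
      obtain ⟨M', hM'⟩ := hdiv m₀ hm₀𝔪
      refine (hQ _).mpr ⟨M', ?_⟩
      have h1 : ψ (T (σ₁ m₀)) = tR * ψ M' := by rw [hM', map_mul, hcomp' a₀]
      rw [hcomp'] at h1
      have h2 : ((ι m₀ : R) : K) = (tR : K) * ((ψ M' : R) : K) := by
        rw [h1]; rfl
      rw [hι, hm₀, htRK] at h2
      change ((ψ M' : R) : K) = ((m : S) : K) / (xK : K)
      rw [eq_div_iff hxK0', mul_comm, ← h2]
  -- conclusion
  intro r
  obtain ⟨a, haB, b, hbB, hbinv, hrab⟩ := hfrac r r.2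
  obtain ⟨A, hA⟩ := (hQ a).mp (hBQ haB)
  obtain ⟨B, hB⟩ := (hQ b).mp (hBQ hbB)
  by_cases hb0 : b = 0
  · refine ⟨0, Subtype.ext ?_⟩
    rw [map_zero, hrab, hb0, div_zero]
    rfl
  · have hbu : IsUnit (ψ B) := (isUnit_subring_iff_inv_mem _).mpr ⟨by rw [hB]; exact hb0, by
      rw [hB]; exact hbinv⟩
    have hBu : IsUnit B := (isUnit_map_iff ψ B).mp hbu
    refine ⟨A * ↑(hBu.unit⁻¹), Subtype.ext ?_⟩
    have hinv : ψ ↑(hBu.unit⁻¹) * ψ B = 1 := by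
      rw [← map_mul, IsUnit.val_inv_mul, map_one]
    have hinvK : ((ψ ↑(hBu.unit⁻¹) : R) : K) = b⁻¹ := by
      have := congrArg (fun r : R => (r : K)) hinv
      simp only [Subring.coe_mul, Subring.coe_one, hB] at this
      exact eq_inv_of_mul_eq_one_left this
    rw [map_mul, Subring.coe_mul, hA, hinvK, hrab, div_eq_mul_inv]


/-- **`𝒪_{X',x'} ≃+* R`** for the blow-up along a centre `I` with `I_x = 𝔪_x`. [cite: StacksProject, Tag 0804] -/
theorem nonempty_stalk_ringEquiv_of_isQuadraticTransform_of_stalkIdeal [IsLocallyNoetherian X] [IsIntegral X']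
    {I : X.IdealSheafData} (hπ : IsBlowup π I) (hIx : stalkIdeal I x = maximalIdeal (X.presheaf.stalk x))
    (R : Subring (FractionRing (X.presheaf.stalk x))) [IsLocalRing R]
    (hQT : IsQuadraticTransform (algebraMap (X.presheaf.stalk x) (FractionRing (X.presheaf.stalk x))).range R)
    (ι : X.presheaf.stalk x →+* R) [IsLocalHom ι]
    (hι : ∀ a, ((ι a : R) : FractionRing (X.presheaf.stalk x)) =
      algebraMap (X.presheaf.stalk x) (FractionRing (X.presheaf.stalk x)) a)
    (φ : Spec (.of R) ⟶ X') (hφ : φ ≫ π = Spec.map (CommRingCat.ofHom ι) ≫ X.fromSpecStalk x)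
    {x' : X'} (hx' : φ (closedPoint R) = x') :
    Nonempty (X'.presheaf.stalk x' ≃+* R) := by
  subst hx'
  have hιinj : Function.Injective ι := fun a b h => by
    apply IsFractionRing.injective (X.presheaf.stalk x) (FractionRing (X.presheaf.stalk x))
    rw [← hι, ← hι, h]
  exact ⟨RingEquiv.ofBijective (Scheme.stalkClosedPointTo φ).hom
    ⟨stalkClosedPointTo_injective_of_isBlowup hπ ι hιinj φ hφ,
      stalkClosedPointTo_surjective_of_isQuadraticTransform_of_stalkIdeal hπ hIx R hQT ι hι φ hφ⟩⟩

end Stalk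

/-- **The p-closed fixed point of the point blow-up (Kollár–Szabó going down, Lemma A.1 shape).** Let `X` be an
integral scheme, `G` a finite group with a normal `p`-subgroup `P` containing all commutators, acting on `X` with `g ∈ I_x` for all `g` at a closed point `x` whose local
ring is regular, not a field, with residue field algebraically closed of characteristic `p`, and `π : X' → X` a blowing up along the
reduced closed point `{x}`, with the lifted action. Then there are a quadratic-transform chart
`(R ⊆ Frac 𝒪_{X,x}, ι, t, φ : Spec R → X')` and the point `x' = φ(closed point)` over `x` such that every `g` lies
in the inertia group of the lifted action at `x'`. [cite: ReichsteinYoussin2000, Appendix, Lemma A.1, Prop. A.2] -/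
theorem exists_fixedPoint_liftAction_of_normal_isPGroup_of_centre {X : Scheme.{0}} [IsIntegral X] {G : Type} [Group G] [Finite G]
    {p : ℕ} [Fact p.Prime] (P : Subgroup G) [P.Normal] (hP : IsPGroup p P)
    (hcomm : ∀ g h : G, g * h * g⁻¹ * h⁻¹ ∈ P)
    (σ : G →* Aut X) {x : X} (hGx : ∀ g, g ∈ inertiaSubgroup σ x)
    [IsRegularLocalRing (X.presheaf.stalk x)] [CharP (ResidueField (X.presheaf.stalk x)) p]
    [IsAlgClosed (ResidueField (X.presheaf.stalk x))]
    (hnf : ¬ IsField (X.presheaf.stalk x))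
    {I : X.IdealSheafData} (hI : ∀ g, I.comap (σ g).hom = I)
    (hIx : stalkIdeal I x = maximalIdeal (X.presheaf.stalk x))
    {X' : Scheme.{0}} {π : X' ⟶ X} (hπ : IsBlowup π I) :
    ∃ (R : Subring (FractionRing (X.presheaf.stalk x))) (_ : IsLocalRing R)
      (ι : X.presheaf.stalk x →+* R) (_ : IsLocalHom ι) (t : R) (φ : Spec (.of R) ⟶ X') (x' : X'),
      IsQuadraticTransform (algebraMap (X.presheaf.stalk x) (FractionRing (X.presheaf.stalk x))).range R ∧
      (∀ a, ((ι a : R) : FractionRing (X.presheaf.stalk x)) =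
        algebraMap (X.presheaf.stalk x) (FractionRing (X.presheaf.stalk x)) a) ∧
      Function.Injective ι ∧ t ≠ 0 ∧ (maximalIdeal (X.presheaf.stalk x)).map ι = Ideal.span {t} ∧
      (∀ r : R, ∃ a, ι a - r ∈ maximalIdeal R) ∧
      φ ≫ π = Spec.map (CommRingCat.ofHom ι) ≫ X.fromSpecStalk x ∧ φ (closedPoint R) = x' ∧ π x' = x ∧
      ∀ g, g ∈ inertiaSubgroup (hπ.liftAction σ hI) x' := by
  -- the stalk action of `G = I_x` and its residue-triviality
  obtain ⟨a, τ, hkey, hτ⟩ := PointBlowupStalkData.exists_stalkAction σ x (⊤ : Subgroup G)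
    (fun g _ => apply_eq_of_mem_inertiaSubgroup σ (hGx g))
  have htop : (⊤ : Subgroup G) ≤ inertiaSubgroup σ x := fun g _ => hGx g
  have hresO : ∀ (g : (⊤ : Subgroup G)) (s : X.presheaf.stalk x), τ g s - s ∈ maximalIdeal _ :=
    InertLocusStalk.stalkAction_residueTrivial σ x a τ hkey hτ htop
  -- the action re-indexed by `G` itself, and the p-closed equivariant quadratic transform
  let τG : G →* (X.presheaf.stalk x ≃+* X.presheaf.stalk x) := τ.comp Subgroup.topEquiv.symm.toMonoidHom
  have hτG : ∀ g, τG g = τ ⟨g, Subgroup.mem_top g⟩ := fun g => rfl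
  have hresG : ∀ (g : G) (s : X.presheaf.stalk x), τG g s - s ∈ maximalIdeal _ := fun g s => by
    rw [hτG]; exact hresO ⟨g, Subgroup.mem_top g⟩ s
  obtain ⟨R, hRloc, ι, hιloc, t, α, hQT, hι, hιinj, ht0, hmap, hα, hres, hcong⟩ :=
    exists_equivariant_quadraticTransform_of_normal_isPGroup hnf P hP hcomm τG hresG
  -- repackage
  let a' : G → (X.presheaf.stalk x ⟶ X.presheaf.stalk x) := fun g => a ⟨g, Subgroup.mem_top g⟩
  have hkey' : ∀ g, Spec.map (a' g) ≫ X.fromSpecStalk x = X.fromSpecStalk x ≫ (σ g).hom := fun g =>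
    hkey ⟨g, Subgroup.mem_top g⟩
  let α' : G → (R →+* R) := fun g => α g⁻¹
  have hα' : ∀ g, (α' g).comp ι = ι.comp (a' g).hom := by
    intro g
    have hinv : (⟨g⁻¹, Subgroup.mem_top _⟩ : (⊤ : Subgroup G))⁻¹ = ⟨g, Subgroup.mem_top g⟩ :=
      Subtype.ext (inv_inv g)
    refine (hα g⁻¹).trans ?_
    ext s
    change ((ι (τ ⟨g⁻¹, Subgroup.mem_top _⟩ s) : R) : FractionRing (X.presheaf.stalk x)) =
      ((ι ((a ⟨g, Subgroup.mem_top g⟩).hom s) : R) : FractionRing (X.presheaf.stalk x))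
    rw [hτ, hinv]
  have hres' : ∀ (g : G) (r : R), α' g r - r ∈ maximalIdeal R := fun g r => hres _ r
  have htnz : t ∈ nonZeroDivisors R := mem_nonZeroDivisors_of_ne_zero ht0
  have hmapI : (stalkIdeal I x).map ι = Ideal.span {t} := by rw [hIx, hmap]
  obtain ⟨φ, x', hφ, hφx', hx'x, hinert⟩ :=
    exists_fixedPoint_liftAction_of_localChart_of_stalkIdeal hπ σ hI a' hkey' ι htnz hmapI α' hα' hres'
  exact ⟨R, hRloc, ι, hιloc, t, φ, x', hQT, hι, hιinj, ht0, hmap, hcong, hφ, hφx', hx'x, hinert⟩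

/-- **The p-closed Kollár–Szabó step reproduces all its hypotheses.** For an integral locally Noetherian `X`, a
finite group `G ⊵ P` (`P` a `p`-group, `[G,G] ≤ P`) with `g ∈ I_x` for all `g` at a closed point `x` with `𝒪_{X,x}`
regular, not a field, `κ(x)` algebraically closed of characteristic `p`, and a blowing up `π : X' → X` of the reduced point `{x}` with its LIFTED action: `X'` is integral
and locally Noetherian, and there is a CLOSED point `x' ∈ X'` over `x`, in the inertia group of every `g`, with
`𝒪_{X',x'}` regular, not a field, of the same dimension as `𝒪_{X,x}`, and `κ(x') ≅ κ(x)`. Point blow-ups at fixed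
points never shrink p-closed inertia with abelian tame part. [cite: ReichsteinYoussin2000, Appendix (Kollár–Szabó), Lemma A.1, Prop. A.2] -/
theorem exists_fixedPoint_liftAction_step_of_normal_isPGroup_of_centre {X : Scheme.{0}} [IsIntegral X] [IsLocallyNoetherian X]
    {G : Type} [Group G] [Finite G] {p : ℕ} [Fact p.Prime] (P : Subgroup G) [P.Normal] (hP : IsPGroup p P)
    (hcomm : ∀ g h : G, g * h * g⁻¹ * h⁻¹ ∈ P)
    (σ : G →* Aut X) {x : X} (hx : IsClosed ({x} : Set X)) (hGx : ∀ g, g ∈ inertiaSubgroup σ x)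
    [IsRegularLocalRing (X.presheaf.stalk x)] [CharP (ResidueField (X.presheaf.stalk x)) p]
    [IsAlgClosed (ResidueField (X.presheaf.stalk x))]
    (hnf : ¬ IsField (X.presheaf.stalk x))
    {I : X.IdealSheafData} (hI : ∀ g, I.comap (σ g).hom = I) (hI0 : I ≠ ⊥)
    (hIx : stalkIdeal I x = maximalIdeal (X.presheaf.stalk x))
    {X' : Scheme.{0}} {π : X' ⟶ X} (hπ : IsBlowup π I) :
    IsIntegral X' ∧ IsLocallyNoetherian X' ∧
    ∃ x' : X', π x' = x ∧ IsClosed ({x'} : Set X') ∧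
      (∀ g, g ∈ inertiaSubgroup (hπ.liftAction σ hI) x') ∧
      IsRegularLocalRing (X'.presheaf.stalk x') ∧ ¬ IsField (X'.presheaf.stalk x') ∧
      ringKrullDim (X'.presheaf.stalk x') = ringKrullDim (X.presheaf.stalk x) ∧
      Nonempty (ResidueField (X'.presheaf.stalk x') ≃+* ResidueField (X.presheaf.stalk x)) := by
  haveI hint : IsIntegral X' := hπ.isIntegral hI0
  haveI : IsLocallyNoetherian X' := hπ.isLocallyNoetherian
  obtain ⟨R, hRloc, ι, hιloc, t, φ, x', hQT, hι, -, -, -, hcong, hφ, hφx', hx'x, hinert⟩ :=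
    exists_fixedPoint_liftAction_of_normal_isPGroup_of_centre P hP hcomm σ hGx hnf hI hIx hπ
  haveI := hRloc
  haveI := hιloc
  -- the model `S` of `𝒪_{X,x}` in its fraction field is a regular local ring
  let O := X.presheaf.stalk x
  let f : O →+* FractionRing O := algebraMap O (FractionRing O)
  have hf : Function.Injective f := IsFractionRing.injective O (FractionRing O)
  have hrr : Function.Injective f.rangeRestrict := fun a b h => hf (congrArg Subtype.val h)
  let e : O ≃+* f.range := RingEquiv.ofBijective f.rangeRestrict ⟨hrr, RingHom.rangeRestrict_surjective f⟩
  haveI : IsRegularLocalRing f.range := IsRegularLocalRing.of_ringEquiv e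
  haveI : IsRegularLocalRing R := isRegularLocalRing_of_isQuadraticTransform _ R hQT
  obtain ⟨eR⟩ := nonempty_stalk_ringEquiv_of_isQuadraticTransform_of_stalkIdeal hπ hIx R hQT ι hι φ hφ hφx'
  -- same residue field
  have hsurj : ∀ z : R, ∃ s : O, z - ι s ∈ maximalIdeal R := fun z => by
    obtain ⟨a, ha⟩ := hcong z
    exact ⟨a, by rw [← neg_sub]; exact neg_mem ha⟩
  have hres : ∀ r : R, ∃ s : f.range, r - Subring.inclusion hQT.dominates.1 s ∈ maximalIdeal R := by
    intro r
    obtain ⟨a, ha⟩ := hsurj r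
    refine ⟨e a, ?_⟩
    have : Subring.inclusion hQT.dominates.1 (e a) = ι a := Subtype.ext (by rw [hι]; rfl)
    rwa [this]
  let eκ : ResidueField O ≃+* ResidueField R :=
    RingEquiv.ofBijective (ResidueField.map ι) (bijective_residueField_map_of_residue_surjective ι hsurj)
  -- dimension and closedness
  have hdimR : ringKrullDim R = ringKrullDim (X.presheaf.stalk x) := by
    rw [ringKrullDim_eq_of_isQuadraticTransform_of_residue _ R hQT hres]
    exact ringKrullDim_eq_of_ringEquiv e.symm
  have hdim : ringKrullDim (X'.presheaf.stalk x') = ringKrullDim (X.presheaf.stalk x) := by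
    rw [ringKrullDim_eq_of_ringEquiv eR, hdimR]
  have hclosed : IsClosed ({x'} : Set X') := by
    refine hπ.isClosed_singleton_of_ringKrullDim_eq (x' := x') (by rw [hx'x]; exact hx) ?_
    rw [hdim, hx'x]
  haveI hreg' : IsRegularLocalRing (X'.presheaf.stalk x') := IsRegularLocalRing.of_ringEquiv eR.symm
  exact ⟨hint, inferInstance, x', hx'x, hclosed, hinert, hreg', not_isField_of_ringKrullDim_eq hdim hnf, hdim,
    ⟨(ResidueField.mapEquiv eR).trans eκ.symm⟩⟩

end Summit.ResolutionOfSingularities.ResolutionOfSingularities.Theorems.WildQuotientResolution.KSGoingDown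

end
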